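import Mathlib.MeasureTheory.Measure.Haar.Unique
import Mathlib.MeasureTheory.Constructions.Pi
import Mathlib.MeasureTheory.Group.LIntegral
import Mathlib.MeasureTheory.Measure.Prod
import HarnessLib

/-!
# The shear `(a₀, a₁) ↦ (a₀ a₁⁻¹, a₁)` and product splitting under a Haar measure of `G × G`

Topic `NumberTheory/Automorphic`; namespace `Literature.NumberTheory.Automorphic`. A measure-theoretic
helper (theorems only) for the plumbing of the Kirillov `L²`-bound into the unfolded Rankin–Selberg
torus integral of `GL_2` (the `n ≤ 2` case of the named fact
`JacquetShalika1981_partialPairL_pole_of_eq_conj`, where the torus `(𝔸_Kˣ)²` is `Fin 2 → 𝔸_Kˣ` with an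
ARBITRARY Haar measure `νA`): for a second countable locally compact ABELIAN group `G`, a Haar measure
`νA` on `Fin 2 → G` and a Haar measure `ν₁` on `G`,

* `haar_pi_eq_smul_pi` — `νA = c • Measure.pi (ν₁, ν₁)` with `c = haarScalarFactor νA (pi ν₁)`
  (uniqueness of Haar measures; `c` is a finite constant whose value is irrelevant);
* `lintegral_shear_eq` — `∫ F(a₀ a₁⁻¹, a₁) dνA(a) = c ∫∫ F(y, a₁) dν₁(y) dν₁(a₁)` for measurable
  `F ≥ 0` (Tonelli and the invariance of `ν₁` under `a₀ ↦ a₀ a₁⁻¹`);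
* `lintegral_shear_mul_le` — hence `∫ F₁(a₀ a₁⁻¹) F₂(a₁) dνA ≤ c (∫ F₁ dν₁) (∫ F₂ dν₁)` (equality).

Standard (Weil (1940), Ch. II; Folland (1995), §2.2–2.3). No definitions, no named facts.

## References

* G. B. Folland, *A Course in Abstract Harmonic Analysis*, CRC Press (1995), §2.2–§2.3 [Folland1995].
-/

noncomputable section

open MeasureTheory Measure Set
open scoped ENNReal NNReal

namespace Literature.NumberTheory.Automorphic

section Shear

variable {G : Type*} [CommGroup G] [TopologicalSpace G] [IsTopologicalGroup G] [LocallyCompactSpace G]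
  [SecondCountableTopology G] [MeasurableSpace G] [BorelSpace G]

/-- **A Haar measure on `G × G = (Fin 2 → G)` is a multiple of the product of Haar measures.** [folklore] -/
theorem haar_pi_eq_smul_pi (νA : Measure (Fin 2 → G)) [IsHaarMeasure νA] (ν₁ : Measure G) [IsHaarMeasure ν₁] :
    νA = haarScalarFactor νA (Measure.pi fun _ : Fin 2 => ν₁) • Measure.pi fun _ : Fin 2 => ν₁ :=
  isMulLeftInvariant_eq_smul νA _

/-- **The shear and Tonelli**: for measurable `F ≥ 0`,
`∫ F(a₀ a₁⁻¹, a₁) dνA(a) = c ∫ (∫ F(y, a₁) dν₁(y)) dν₁(a₁)`, `c = haarScalarFactor νA (pi ν₁)`. [cite: Folland1995, §2.2] -/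
theorem lintegral_shear_eq (νA : Measure (Fin 2 → G)) [IsHaarMeasure νA] (ν₁ : Measure G) [IsHaarMeasure ν₁]
    {F : G → G → ℝ≥0∞} (hF : Measurable (Function.uncurry F)) :
    ∫⁻ a, F (a 0 * (a 1)⁻¹) (a 1) ∂νA =
      haarScalarFactor νA (Measure.pi fun _ : Fin 2 => ν₁) * ∫⁻ a₁, ∫⁻ y, F y a₁ ∂ν₁ ∂ν₁ := by
  set c := haarScalarFactor νA (Measure.pi fun _ : Fin 2 => ν₁) with hc
  -- replace `νA` by `c • pi`
  conv_lhs => rw [haar_pi_eq_smul_pi νA ν₁]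
  rw [lintegral_smul_measure]
  congr 1
  -- `pi = prod` through `piFinTwo`
  have hmp := measurePreserving_piFinTwo (fun _ : Fin 2 => ν₁)
  have hmeas : Measurable fun p : G × G => F (p.1 * p.2⁻¹) p.2 :=
    hF.comp ((measurable_fst.mul measurable_snd.inv).prodMk measurable_snd)
  have h1 : ∫⁻ a : Fin 2 → G, F (a 0 * (a 1)⁻¹) (a 1) ∂(Measure.pi fun _ : Fin 2 => ν₁) =
      ∫⁻ p : G × G, F (p.1 * p.2⁻¹) p.2 ∂(ν₁.prod ν₁) := by
    rw [← hmp.lintegral_comp hmeas]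
    rfl
  rw [h1, lintegral_prod_symm _ hmeas.aemeasurable]
  refine lintegral_congr fun a₁ => ?_
  -- invariance of `ν₁` under `y ↦ y a₁⁻¹`
  exact lintegral_mul_right_eq_self (fun y => F y a₁) a₁⁻¹

/-- **Product splitting**: `∫ F₁(a₀ a₁⁻¹) F₂(a₁) dνA(a) = c (∫ F₁ dν₁) (∫ F₂ dν₁)`. [folklore] -/
theorem lintegral_shear_mul_eq (νA : Measure (Fin 2 → G)) [IsHaarMeasure νA] (ν₁ : Measure G) [IsHaarMeasure ν₁]
    {F₁ F₂ : G → ℝ≥0∞} (hF₁ : Measurable F₁) (hF₂ : Measurable F₂) :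
    ∫⁻ a, F₁ (a 0 * (a 1)⁻¹) * F₂ (a 1) ∂νA =
      haarScalarFactor νA (Measure.pi fun _ : Fin 2 => ν₁) * ((∫⁻ y, F₁ y ∂ν₁) * ∫⁻ a₁, F₂ a₁ ∂ν₁) := by
  rw [lintegral_shear_eq νA ν₁ (F := fun y a₁ => F₁ y * F₂ a₁) ((hF₁.comp measurable_fst).mul (hF₂.comp measurable_snd))]
  congr 1
  have h : ∀ a₁, ∫⁻ y, F₁ y * F₂ a₁ ∂ν₁ = (∫⁻ y, F₁ y ∂ν₁) * F₂ a₁ := fun a₁ => lintegral_mul_const _ hF₁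
  simp_rw [h]
  rw [lintegral_const_mul _ hF₂]

/-- The scalar is finite: the shear integral is finite as soon as the two factors are. [folklore] -/
theorem lintegral_shear_mul_lt_top (νA : Measure (Fin 2 → G)) [IsHaarMeasure νA] (ν₁ : Measure G) [IsHaarMeasure ν₁]
    {F₁ F₂ : G → ℝ≥0∞} (hF₁ : Measurable F₁) (hF₂ : Measurable F₂) (h₁ : ∫⁻ y, F₁ y ∂ν₁ < ⊤) (h₂ : ∫⁻ a₁, F₂ a₁ ∂ν₁ < ⊤) :
    ∫⁻ a, F₁ (a 0 * (a 1)⁻¹) * F₂ (a 1) ∂νA < ⊤ := by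
  rw [lintegral_shear_mul_eq νA ν₁ hF₁ hF₂]
  exact ENNReal.mul_lt_top ENNReal.coe_lt_top (ENNReal.mul_lt_top h₁ h₂)

end Shear

end Literature.NumberTheory.Automorphic
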